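import Summits.Ventures.Crystal3D.Theorems.StickyWulffConstantGenericWallFloorLineCountOffset
import Summits.Ventures.Crystal3D.Theorems.StickyWulffConstantGenericWallFloorAffineDiscCountUpper
import HarnessLib

/-!
# Bond lines through a slab sample, counted from ABOVE (per transversal class)

HONEST FRAMING. Part of the venture `Summits/Ventures/Crystal3D` (cell `crystal3d-full`), helper for the
crux `GenericWallFloor` (stmt-Ventures-19480) of `route-Ventures-StickyWulffConstant`, line `WallLedgerG`:
module M1 of the rigid-bicrystal rung of `stub_twoSlabAdhesion` (note RIGID-RUNG-ARCH on the item) needs the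
clamped samples' deficiency from ABOVE, `D(P) ≤ 2φπρ² + C(A)ρ`, because they enter the stub's inequality with
a minus sign.  This file is the per-class half: the mirror image of `lineCount_offset_window`.

**Theorem** (`lineCount_upper_offset_window`).  `ν` unit, `R, ρ ≥ 0`, `Ea, Eb` of norm `≤ 1`, `W` unit with
`det(Ea, Eb, W)² = 1/2` and `α = ⟪W, ν⟫ ≠ 0`, `s` any offset, `lo` any window base.  If EVERY `(a, b)` of a
finite `T ⊆ ℤ²` has an integer `t` putting `a•Ea + b•Eb + t•W + s` in the slab sample
`{lo ≤ ⟪p,ν⟫ ≤ lo + R, ‖p‖² − ⟪p,ν⟫² ≤ ρ²}`, then `#T ≤ √2 |α| π (ρ + (R/2 + 4)/|α|)²`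
(`= √2|α|πρ² + √2π(R + 8)ρ + √2π(R/2 + 4)²/|α|`: the constant degrades as the class becomes horizontal, which is
harmless since the six classes of a fixed lattice orientation have fixed `α`'s).
Proof: the mid-plane crossing of such a line lies within lateral distance `ρ + R/(2|α|)` of the axis; plane
coordinates, the shear identity `√2|α| |det A| = 1` and the upper affine disc count with cell diameter
`r = ‖X‖ + ‖Y‖ ≤ 4/|α|`.

WHAT THIS IS NOT: the horizontal classes (`α = 0`) and the assembly over the six classes are not here; rung
F-C1 not moved.
-/

noncomputable section

namespace Summit.Ventures.Crystal3D.Theorems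

open Summit.Ventures.Crystal3D Matrix
open scoped InnerProductSpace

/-- **Per-class UPPER line count with an offset and an arbitrary window.** -/
theorem lineCount_upper_offset_window (ν : EuclideanSpace ℝ (Fin 3)) (hν : ‖ν‖ = 1)
    (R ρ lo : ℝ) (hR : 0 ≤ R) (hρ : 0 ≤ ρ) (Ea Eb W s : EuclideanSpace ℝ (Fin 3))
    (hEa : ‖Ea‖ ≤ 1) (hEb : ‖Eb‖ ≤ 1) (hW : ‖W‖ = 1)
    (hdet : (Matrix.det ![WithLp.ofLp Ea, WithLp.ofLp Eb, WithLp.ofLp W]) ^ 2 = 1 / 2)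
    (hα : ⟪W, ν⟫_ℝ ≠ 0) (T : Finset (ℤ × ℤ))
    (hT : ∀ p ∈ T, ∃ t : ℤ,
      lo ≤ ⟪(p.1 : ℝ) • Ea + (p.2 : ℝ) • Eb + (t : ℝ) • W + s, ν⟫_ℝ ∧
      ⟪(p.1 : ℝ) • Ea + (p.2 : ℝ) • Eb + (t : ℝ) • W + s, ν⟫_ℝ ≤ lo + R ∧
      ‖(p.1 : ℝ) • Ea + (p.2 : ℝ) • Eb + (t : ℝ) • W + s‖ ^ 2 -
          ⟪(p.1 : ℝ) • Ea + (p.2 : ℝ) • Eb + (t : ℝ) • W + s, ν⟫_ℝ ^ 2 ≤ ρ ^ 2) :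
    (T.card : ℝ) ≤ Real.sqrt 2 * |⟪W, ν⟫_ℝ| * Real.pi * (ρ + (R / 2 + 4) / |⟪W, ν⟫_ℝ|) ^ 2 := by
  have h2pos : 0 < Real.sqrt 2 := Real.sqrt_pos.2 (by norm_num)
  have h2sq : Real.sqrt 2 ^ 2 = 2 := Real.sq_sqrt (by norm_num)
  set α : ℝ := ⟪W, ν⟫_ℝ with hαdef
  set m : ℝ := lo + R / 2 with hmdef
  have hαpos : 0 < |α| := abs_pos.2 hα
  have hνν : ⟪ν, ν⟫_ℝ = 1 := by rw [real_inner_self_eq_norm_sq, hν, one_pow]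
  have hEaν : |⟪Ea, ν⟫_ℝ| ≤ 1 := by
    have h := abs_real_inner_le_norm Ea ν; rw [hν, mul_one] at h; exact h.trans hEa
  have hEbν : |⟪Eb, ν⟫_ℝ| ≤ 1 := by
    have h := abs_real_inner_le_norm Eb ν; rw [hν, mul_one] at h; exact h.trans hEb
  -- the oblique projections and the lateral centre
  set X : EuclideanSpace ℝ (Fin 3) := Ea - (⟪Ea, ν⟫_ℝ / α) • W with hX
  set Y : EuclideanSpace ℝ (Fin 3) := Eb - (⟪Eb, ν⟫_ℝ / α) • W with hY
  set c₀ : EuclideanSpace ℝ (Fin 3) := s + ((m - ⟪s, ν⟫_ℝ) / α) • W - m • ν with hc₀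
  have hXν : ⟪X, ν⟫_ℝ = 0 := by
    rw [hX, inner_sub_left, inner_smul_left]; simp only [conj_trivial]; rw [← hαdef]; field_simp; ring
  have hYν : ⟪Y, ν⟫_ℝ = 0 := by
    rw [hY, inner_sub_left, inner_smul_left]; simp only [conj_trivial]; rw [← hαdef]; field_simp; ring
  have hc₀ν : ⟪c₀, ν⟫_ℝ = 0 := by
    rw [hc₀, inner_sub_left, inner_add_left, inner_smul_left, inner_smul_left]; simp only [conj_trivial]
    rw [hνν, ← hαdef]; field_simp; ring
  have hXn : |α| * ‖X‖ ≤ 2 := by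
    have h1 : |α| * ‖X‖ = ‖α • Ea - ⟪Ea, ν⟫_ℝ • W‖ := by
      rw [← Real.norm_eq_abs, ← norm_smul, hX, smul_sub, smul_smul, mul_div_cancel₀ _ hα]
    rw [h1]
    have h2 : ‖α • Ea - ⟪Ea, ν⟫_ℝ • W‖ ≤ |α| * ‖Ea‖ + |⟪Ea, ν⟫_ℝ| * ‖W‖ := by
      calc ‖α • Ea - ⟪Ea, ν⟫_ℝ • W‖ ≤ ‖α • Ea‖ + ‖⟪Ea, ν⟫_ℝ • W‖ := norm_sub_le _ _
        _ = |α| * ‖Ea‖ + |⟪Ea, ν⟫_ℝ| * ‖W‖ := by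
            rw [norm_smul, norm_smul, Real.norm_eq_abs, Real.norm_eq_abs]
    rw [hW, mul_one] at h2
    have hαle : |α| ≤ 1 := by
      have h := abs_real_inner_le_norm W ν; rw [hW, hν, one_mul] at h; exact h
    nlinarith [abs_nonneg α, norm_nonneg Ea, abs_nonneg ⟪Ea, ν⟫_ℝ]
  have hYn : |α| * ‖Y‖ ≤ 2 := by
    have h1 : |α| * ‖Y‖ = ‖α • Eb - ⟪Eb, ν⟫_ℝ • W‖ := by
      rw [← Real.norm_eq_abs, ← norm_smul, hY, smul_sub, smul_smul, mul_div_cancel₀ _ hα]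
    rw [h1]
    have h2 : ‖α • Eb - ⟪Eb, ν⟫_ℝ • W‖ ≤ |α| * ‖Eb‖ + |⟪Eb, ν⟫_ℝ| * ‖W‖ := by
      calc ‖α • Eb - ⟪Eb, ν⟫_ℝ • W‖ ≤ ‖α • Eb‖ + ‖⟪Eb, ν⟫_ℝ • W‖ := norm_sub_le _ _
        _ = |α| * ‖Eb‖ + |⟪Eb, ν⟫_ℝ| * ‖W‖ := by
            rw [norm_smul, norm_smul, Real.norm_eq_abs, Real.norm_eq_abs]
    rw [hW, mul_one] at h2
    have hαle : |α| ≤ 1 := by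
      have h := abs_real_inner_le_norm W ν; rw [hW, hν, one_mul] at h; exact h
    nlinarith [abs_nonneg α, norm_nonneg Eb, abs_nonneg ⟪Eb, ν⟫_ℝ]
  set r : ℝ := ‖X‖ + ‖Y‖ with hr
  have hr0 : 0 ≤ r := by positivity
  have hrα : r ≤ 4 / |α| := by
    rw [le_div_iff₀ hαpos, hr]; nlinarith
  -- plane coordinates and the Gram identity
  obtain ⟨A, β, hAβ, hdetA, hAf⟩ := exists_planeCoordinates ν X Y c₀ hν hXν hYν hc₀ν
  have hgram := sq_mul_gram_shear_euclidean Ea Eb W ν hα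
  rw [← hαdef, ← hX, ← hY, hdet, hν, one_pow, mul_one, ← hdetA] at hgram
  have hdetabs : Real.sqrt 2 * |α| * |A.det| = 1 := by
    have hnn : 0 ≤ Real.sqrt 2 * |α| * |A.det| := by positivity
    have hsq : (Real.sqrt 2 * |α| * |A.det|) ^ 2 = 1 := by
      rw [mul_pow, mul_pow, h2sq, sq_abs, sq_abs]; linarith
    exact (pow_eq_one_iff_of_nonneg hnn (by norm_num)).1 hsq
  have hAdet : A.det ≠ 0 := by
    intro h; rw [h, abs_zero, mul_zero] at hdetabs; exact zero_ne_one hdetabs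
  have hbound : ∀ f : Fin 2 → ℝ, (∀ i, 0 ≤ f i ∧ f i < 1) →
      (A.mulVec f 0) ^ 2 + (A.mulVec f 1) ^ 2 ≤ r ^ 2 := by
    intro f hf
    rw [hAf]
    have h0 := hf 0; have h1 := hf 1
    have hle : ‖f 0 • X + f 1 • Y‖ ≤ r := by
      calc ‖f 0 • X + f 1 • Y‖ ≤ ‖f 0 • X‖ + ‖f 1 • Y‖ := norm_add_le _ _
        _ = |f 0| * ‖X‖ + |f 1| * ‖Y‖ := by rw [norm_smul, norm_smul, Real.norm_eq_abs, Real.norm_eq_abs]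
        _ ≤ 1 * ‖X‖ + 1 * ‖Y‖ := by
            gcongr
            · rw [abs_of_nonneg h0.1]; exact h0.2.le
            · rw [abs_of_nonneg h1.1]; exact h1.2.le
        _ = r := by rw [hr]; ring
    exact pow_le_pow_left₀ (norm_nonneg _) hle 2
  -- the enlarged radius
  set ρ' : ℝ := ρ + R / 2 / |α| with hρ'
  have hρ'0 : 0 ≤ ρ' := by positivity
  -- every line of `T` has its mid-plane crossing within lateral distance `ρ'`
  have hdisc := affine_disc_count_upper A hAdet β 0 r ρ' hr0 hρ'0 hbound T ?_
  swap
  · intro ij hij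
    obtain ⟨t, ht1, ht2, ht3⟩ := hT ij hij
    simp only [Pi.zero_apply, sub_zero]
    rw [← hAβ]
    -- the sample point `p` and the crossing `Q`
    set P₀ : EuclideanSpace ℝ (Fin 3) := (ij.1 : ℝ) • Ea + (ij.2 : ℝ) • Eb + s with hP₀
    set p : EuclideanSpace ℝ (Fin 3) := (ij.1 : ℝ) • Ea + (ij.2 : ℝ) • Eb + (t : ℝ) • W + s with hp
    have hpP : p = P₀ + (t : ℝ) • W := by rw [hp, hP₀]; abel
    have hP₀ν : ⟪P₀, ν⟫_ℝ = (ij.1 : ℝ) * ⟪Ea, ν⟫_ℝ + (ij.2 : ℝ) * ⟪Eb, ν⟫_ℝ + ⟪s, ν⟫_ℝ := by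
      rw [hP₀, inner_add_left, inner_add_left, inner_smul_left, inner_smul_left]; simp
    -- `c₀ + iX + jY` is the lateral part of the crossing point
    have heq : c₀ + (ij.1 : ℝ) • X + (ij.2 : ℝ) • Y =
        P₀ + ((m - ⟪P₀, ν⟫_ℝ) / α) • W - m • ν := by
      rw [hP₀ν, hc₀, hX, hY, hP₀]
      have e1 : (m - ((ij.1 : ℝ) * ⟪Ea, ν⟫_ℝ + (ij.2 : ℝ) * ⟪Eb, ν⟫_ℝ + ⟪s, ν⟫_ℝ)) / α =
          -((ij.1 : ℝ) * (⟪Ea, ν⟫_ℝ / α)) - (ij.2 : ℝ) * (⟪Eb, ν⟫_ℝ / α) + (m - ⟪s, ν⟫_ℝ) / α := by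
        field_simp; ring
      rw [e1]
      module
    -- … and also `(p − ⟪p,ν⟫ν) + λ (W − α ν)` with `λ = (m − ⟪p,ν⟫)/α`, `|λ| ≤ R/(2|α|)`
    have hpν : ⟪p, ν⟫_ℝ = ⟪P₀, ν⟫_ℝ + (t : ℝ) * α := by
      rw [hpP, inner_add_left, inner_smul_left]; simp [hαdef]
    set lam : ℝ := (m - ⟪p, ν⟫_ℝ) / α with hlam
    have s1 : (m - ⟪P₀, ν⟫_ℝ) / α = (t : ℝ) + lam := by
      rw [hlam, hpν]; field_simp; ring
    have s2 : lam * α = m - ⟪p, ν⟫_ℝ := by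
      rw [hlam]; field_simp
    have heq2 : P₀ + ((m - ⟪P₀, ν⟫_ℝ) / α) • W - m • ν =
        (p - ⟪p, ν⟫_ℝ • ν) + lam • (W - α • ν) := by
      rw [s1, show m • ν = (⟪p, ν⟫_ℝ + lam * α) • ν by rw [s2]; ring_nf, hpP]
      module
    have hlam_le : |lam| ≤ R / 2 / |α| := by
      rw [hlam, abs_div, div_le_div_iff_of_pos_right hαpos, abs_le]
      constructor
      · rw [hmdef]; linarith only [ht2]
      · rw [hmdef]; linarith only [ht1]
    have hplat : ‖p - ⟪p, ν⟫_ℝ • ν‖ ≤ ρ := by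
      have h2 : ‖p - ⟪p, ν⟫_ℝ • ν‖ ^ 2 ≤ ρ ^ 2 := by
        rw [norm_sub_inner_smul_sq ν _ hν]; exact ht3
      exact (pow_le_pow_iff_left₀ (norm_nonneg _) hρ two_ne_zero).1 h2
    have hWlat : ‖W - α • ν‖ ≤ 1 := by
      have h2 : ‖W - α • ν‖ ^ 2 ≤ 1 ^ 2 := by
        rw [hαdef, norm_sub_inner_smul_sq ν _ hν, hW]
        nlinarith only [sq_nonneg ⟪W, ν⟫_ℝ]
      exact (pow_le_pow_iff_left₀ (norm_nonneg _) zero_le_one two_ne_zero).1 h2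
    have hQlat : ‖c₀ + (ij.1 : ℝ) • X + (ij.2 : ℝ) • Y‖ ≤ ρ' := by
      rw [heq, heq2]
      calc ‖(p - ⟪p, ν⟫_ℝ • ν) + lam • (W - α • ν)‖
          ≤ ‖p - ⟪p, ν⟫_ℝ • ν‖ + ‖lam • (W - α • ν)‖ := norm_add_le _ _
        _ = ‖p - ⟪p, ν⟫_ℝ • ν‖ + |lam| * ‖W - α • ν‖ := by rw [norm_smul, Real.norm_eq_abs]
        _ ≤ ρ + R / 2 / |α| * 1 := by gcongr
        _ = ρ' := by rw [hρ']; ring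
    exact pow_le_pow_left₀ (norm_nonneg _) hQlat 2
  -- assemble: `#T · |det A| ≤ π (ρ' + r)²`, `√2|α||det A| = 1`, `r ≤ 4/|α|`
  have hcard : (T.card : ℝ) = Real.sqrt 2 * |α| * (|A.det| * (T.card : ℝ)) := by
    calc (T.card : ℝ) = (Real.sqrt 2 * |α| * |A.det|) * (T.card : ℝ) := by rw [hdetabs, one_mul]
      _ = Real.sqrt 2 * |α| * (|A.det| * (T.card : ℝ)) := by ring
  rw [hcard]
  have hmono : Real.pi * (ρ' + r) ^ 2 ≤ Real.pi * (ρ + (R / 2 + 4) / |α|) ^ 2 := by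
    have h1 : ρ' + r ≤ ρ + (R / 2 + 4) / |α| := by
      rw [hρ', add_div]; linarith only [hrα]
    have h0 : 0 ≤ ρ' + r := by positivity
    exact mul_le_mul_of_nonneg_left (pow_le_pow_left₀ h0 h1 2) Real.pi_pos.le
  calc Real.sqrt 2 * |α| * (|A.det| * (T.card : ℝ))
      ≤ Real.sqrt 2 * |α| * (Real.pi * (ρ' + r) ^ 2) :=
        mul_le_mul_of_nonneg_left hdisc (by positivity)
    _ ≤ Real.sqrt 2 * |α| * (Real.pi * (ρ + (R / 2 + 4) / |α|) ^ 2) :=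
        mul_le_mul_of_nonneg_left hmono (by positivity)
    _ = Real.sqrt 2 * |α| * Real.pi * (ρ + (R / 2 + 4) / |α|) ^ 2 := by ring

end Summit.Ventures.Crystal3D.Theorems

end
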